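import Mathlib
import Summits.ValiantsHypothesis.ValiantsHypothesis.Theorems.DivisionGapPerMultiplesHardPushOff
import Literature.Computability.AlgebraicComplexity.ArithCircuitProofs
import Literature.Computability.AlgebraicComplexity.PermanentIrreducible

/-!
# `DivisionGap.PerMultiplesHard` (stmt-ValiantsHypothesis-5068), line `uncharged-face-walk`:
the face `1_G` cuts the complete class on the host out of the cofactor (stub `stub_faceOntoHost`)

For a face `G ⊆ [n]²` let `per_G := ∑_{σ ⊆ G} x^{μ_σ}` be the face permanent.  Let `t` be a
torus-homogeneous cofactor over `ℝ≥0` with margins `(R, C)` (every monomial of `t` has row sums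
`R` and column sums `C`) which is COMPLETE on `G` (every `G`-table with margins `(R, C)` is a
monomial of `t`), and assume some `G`-table with margins `(R, C)` exists.  Then there is a nonzero
`t₁` whose support is EXACTLY the set of `G`-tables with margins `(R, C)`, with
`L⁺(per_G · t₁) ≤ L⁺(per_G · t)` for the tree's monotone fan-in-two `complexity` over `ℝ≥0`.

Mechanism.  `t₁ := top_w t` for the indicator weight `w = 1_G`.  The `w`-weight of a monomial
`M` is its mass on `G`, at most its degree `Σ_e M e = Σ_i R i`, with equality iff `supp M ⊆ G`
(`weight_indicator_le`, `weight_indicator_eq_iff`); the `G`-table of the third hypothesis is a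
monomial of `t` (completeness) of weight `Σ_i R i`, so `deg_w t = Σ_i R i` and
`supp (top_w t) = {M ∈ supp t : supp M ⊆ G}`, which by completeness and torus-homogeneity is the
set of all `G`-tables with margins `(R, C)`.  Finally `per_G` is `w`-homogeneous of weight `n`
(all `n` cells of a permutation inside `G` lie in `G`), so `top_w (per_G · t) = per_G · top_w t`
(`topComponent_mul`, `topComponent_eq_self_of_isWeightedHomogeneous`) and top components are free
(`complexity_topComponent_le`).

Log (stub-worker): written on the landed `TopComponentFree` / `FaceDescent` / `PushOff` API.
[folklore]
-/

noncomputable section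

set_option linter.dupNamespace false

open MvPolynomial Literature.Computability.AlgebraicComplexity
open scoped NNReal BigOperators
open Summit.ValiantsHypothesis.ValiantsHypothesis.Theorems.ZeroOneTransfer.Negative

namespace Summit.ValiantsHypothesis.ValiantsHypothesis.Theorems.DivisionGap.PerMultiplesHard.FaceOntoHost

variable {n : ℕ}

/-! ### The indicator weight `1_G` -/

/-- The `1_G`-weight of a monomial is its mass on `G`. [folklore] -/
theorem weight_indicator (G : Finset (Fin n × Fin n)) (M : (Fin n × Fin n) →₀ ℕ) :
    Finsupp.weight (fun e : Fin n × Fin n => if e ∈ G then (1 : ℕ) else 0) M =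
      ∑ e, if e ∈ G then M e else 0 := by
  rw [Finsupp.weight_apply, Finsupp.sum_fintype _ _ (fun e => by simp)]
  exact Finset.sum_congr rfl fun e _ => by split_ifs <;> simp

/-- The mass on `G` is at most the degree. [folklore] -/
theorem weight_indicator_le (G : Finset (Fin n × Fin n)) (M : (Fin n × Fin n) →₀ ℕ) :
    Finsupp.weight (fun e : Fin n × Fin n => if e ∈ G then (1 : ℕ) else 0) M ≤ ∑ e, M e := by
  rw [weight_indicator]
  exact Finset.sum_le_sum fun e _ => by split_ifs <;> simp

/-- The mass on `G` is the degree iff the monomial lives on `G`. [folklore] -/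
theorem weight_indicator_eq_iff (G : Finset (Fin n × Fin n)) (M : (Fin n × Fin n) →₀ ℕ) :
    Finsupp.weight (fun e : Fin n × Fin n => if e ∈ G then (1 : ℕ) else 0) M = ∑ e, M e ↔
      M.support ⊆ G := by
  rw [weight_indicator]
  constructor
  · intro h e he
    by_contra heG
    have hlt : ∑ e, (if e ∈ G then M e else 0) < ∑ e, M e := by
      refine Finset.sum_lt_sum (fun e _ => by split_ifs <;> simp) ⟨e, Finset.mem_univ e, ?_⟩
      rw [if_neg heG]
      exact Nat.pos_of_ne_zero (Finsupp.mem_support_iff.1 he)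
    exact absurd h hlt.ne
  · intro h
    refine Finset.sum_congr rfl fun e _ => ?_
    split_ifs with heG
    · rfl
    · exact (Finsupp.notMem_support_iff.1 fun he => heG (h he)).symm

/-- The degree of a monomial with row sums `R` is `Σ_i R i`. [folklore] -/
theorem sum_eq_sum_rows {R : Fin n → ℕ} {M : (Fin n × Fin n) →₀ ℕ}
    (hR : ∀ i, ∑ j, M (i, j) = R i) : ∑ e, M e = ∑ i, R i := by
  rw [Fintype.sum_prod_type]
  exact Finset.sum_congr rfl fun i _ => hR i

/-- The face permanent `per_G` is `1_G`-homogeneous of weight `n`: all `n` cells of a permutation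
inside `G` lie in `G`. [folklore] -/
theorem isWeightedHomogeneous_facePer_indicator (G : Finset (Fin n × Fin n)) :
    IsWeightedHomogeneous (fun e : Fin n × Fin n => if e ∈ G then (1 : ℕ) else 0)
      (∑ σ ∈ (Finset.univ : Finset (Equiv.Perm (Fin n))).filter (fun σ => ∀ i, (σ i, i) ∈ G),
        monomial (permMonomial σ) (1 : ℝ≥0)) n := by
  refine IsWeightedHomogeneous.sum _ _ n fun ρ hρ => isWeightedHomogeneous_monomial _ _ _ ?_
  have hρG : ∀ i, (ρ i, i) ∈ G := (Finset.mem_filter.1 hρ).2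
  rw [FaceDescent.weight_permMonomial]
  calc ∑ i, (fun e : Fin n × Fin n => if e ∈ G then (1 : ℕ) else 0) (ρ i, i)
        = ∑ _i : Fin n, (1 : ℕ) := Finset.sum_congr rfl fun i _ => by
          simp only []
          rw [if_pos (hρG i)]
    _ = n := by simp

/-- Support of a top component: the monomials of `p` of top weighted degree. [folklore] -/
theorem mem_support_topComponent_iff {τ : Type*} (w : τ → ℕ) (p : MvPolynomial τ ℝ≥0)
    (d : τ →₀ ℕ) :
    d ∈ (topComponent w p).support ↔
      d ∈ p.support ∧ Finsupp.weight w d = weightedTotalDegree w p := by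
  rw [mem_support_iff, mem_support_iff, coeff_topComponent]
  split_ifs with h
  · simp [h]
  · simp [h]

/-! ### The stub -/

/-- **The face `1_G` cuts the complete class on the host out of the cofactor** (stub
`stub_faceOntoHost` of line `uncharged-face-walk`).  If `t` is torus-homogeneous with margins
`(R, C)`, complete on `G`, and some `G`-table with margins `(R, C)` exists, then
`t₁ := top_{1_G} t ≠ 0` has support exactly the set of `G`-tables with margins `(R, C)` and
`L⁺(per_G · t₁) ≤ L⁺(per_G · t)`. [folklore] -/
theorem stub_faceOntoHost :
    ∀ (n : ℕ) (G : Finset (Fin n × Fin n)) (t : MvPolynomial (Fin n × Fin n) ℝ≥0) (R C : Fin n → ℕ),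
      (∀ m ∈ t.support, (∀ i, ∑ j, m (i, j) = R i) ∧ (∀ j, ∑ i, m (i, j) = C j)) →
      (∀ M : (Fin n × Fin n) →₀ ℕ, M.support ⊆ G →
        (∀ i, ∑ j, M (i, j) = R i) → (∀ j, ∑ i, M (i, j) = C j) → M ∈ t.support) →
      (∃ M : (Fin n × Fin n) →₀ ℕ, M.support ⊆ G ∧ (∀ i, ∑ j, M (i, j) = R i) ∧ (∀ j, ∑ i, M (i, j) = C j)) →
      ∃ t₁ : MvPolynomial (Fin n × Fin n) ℝ≥0, t₁ ≠ 0 ∧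
        (∀ M : (Fin n × Fin n) →₀ ℕ, M ∈ t₁.support ↔
          M.support ⊆ G ∧ (∀ i, ∑ j, M (i, j) = R i) ∧ (∀ j, ∑ i, M (i, j) = C j)) ∧
        complexity ((∑ σ ∈ (Finset.univ : Finset (Equiv.Perm (Fin n))).filter (fun σ => ∀ i, (σ i, i) ∈ G),
            monomial (permMonomial σ) (1 : ℝ≥0)) * t₁) ≤
          complexity ((∑ σ ∈ (Finset.univ : Finset (Equiv.Perm (Fin n))).filter (fun σ => ∀ i, (σ i, i) ∈ G),
            monomial (permMonomial σ) (1 : ℝ≥0)) * t) := by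
  intro n G t R C htor hcomp hex
  obtain ⟨M₀, hM₀G, hM₀R, hM₀C⟩ := hex
  -- the `G`-table is a monomial of `t` (completeness), so `t ≠ 0`
  have hM₀t : M₀ ∈ t.support := hcomp M₀ hM₀G hM₀R hM₀C
  have ht : t ≠ 0 := support_nonempty.1 ⟨M₀, hM₀t⟩
  -- the top `1_G`-degree of `t` is `Σ_i R i`
  have hdeg : weightedTotalDegree (fun e : Fin n × Fin n => if e ∈ G then (1 : ℕ) else 0) t =
      ∑ i, R i := by
    refine le_antisymm (Finset.sup_le fun d hd => ?_) ?_
    · exact (weight_indicator_le G d).trans_eq (sum_eq_sum_rows (htor d hd).1)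
    · have h := le_weightedTotalDegree (fun e : Fin n × Fin n => if e ∈ G then (1 : ℕ) else 0) hM₀t
      rwa [(weight_indicator_eq_iff G M₀).2 hM₀G, sum_eq_sum_rows hM₀R] at h
  refine ⟨topComponent (fun e : Fin n × Fin n => if e ∈ G then (1 : ℕ) else 0) t,
    topComponent_ne_zero _ ht, fun M => ?_, ?_⟩
  · -- the support of the top component is the complete class on `G`
    rw [mem_support_topComponent_iff, hdeg]
    constructor
    · rintro ⟨hMt, hw⟩
      obtain ⟨hR, hC⟩ := htor M hMt
      rw [← sum_eq_sum_rows hR] at hw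
      exact ⟨(weight_indicator_eq_iff G M).1 hw, hR, hC⟩
    · rintro ⟨hMG, hR, hC⟩
      refine ⟨hcomp M hMG hR hC, ?_⟩
      rw [(weight_indicator_eq_iff G M).2 hMG, sum_eq_sum_rows hR]
  · -- free: top components are multiplicative and `per_G` is `1_G`-homogeneous
    have h := complexity_topComponent_le (fun e : Fin n × Fin n => if e ∈ G then (1 : ℕ) else 0)
      ((∑ σ ∈ (Finset.univ : Finset (Equiv.Perm (Fin n))).filter (fun σ => ∀ i, (σ i, i) ∈ G),
        monomial (permMonomial σ) (1 : ℝ≥0)) * t)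
    rwa [topComponent_mul, topComponent_eq_self_of_isWeightedHomogeneous _
      (isWeightedHomogeneous_facePer_indicator G)] at h

end Summit.ValiantsHypothesis.ValiantsHypothesis.Theorems.DivisionGap.PerMultiplesHard.FaceOntoHost

end
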